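import Mathlib.Tactic.Ring
import Mathlib.Tactic.Linarith
import Mathlib.Tactic.Positivity
import Mathlib.Tactic.LinearCombination
import Mathlib.Data.Real.Basic
import Summits.HodgeConjecture.HodgeConjecture.Theorems.WeilClassTestFormatFiveThreeQ2
import Summits.HodgeConjecture.HodgeConjecture.Theorems.WeilClassTestFormatFiveThreeLineQuintic
import HarnessLib

/-!
# Conjecture N (hodge-weil ladder, GAPS G51b), format (5,3), real charges: EMPTY CHARGE PATTERNS FROM THE LINE ∩ QUINTIC PICTURE

Prover 2, generation 17 (note `run/shared/lean/b2b/hodge-weil/b2b-hweil-pv2-g17/REAL-N53-G17.md`); continuation of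
`WeilClassTestFormatFiveThreeLineQuintic.lean` (the identity `lineId`: on the pure locus the E-charges are the intersections of the line
`ℓ` with the quintic `P(t) = ∏_g(t − v_g)·(t² − S/2)`; wall values `w(u_e)∏_g(u_e − v_g) = ℓ(u_e)`; `Q₄ = 12·slope(ℓ)`; and
`no_config_of_walls_neg/pos`: one-signed walls are impossible). Charge patterns `(n₁,n₂,n₃)` = numbers of E-charges below the sorted
F-charges `v₁ ≤ v₂ ≤ v₃`. THEOREMS:
* `no_config_n1two_n3three` — the patterns (2,2,3), (2,3,3) carry NO centred configuration with `P2 = P4 = 0` that is pairwise ample: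
  `ℓ(v₁) = K₀(1) > 0 > K₀(3) = ℓ(v₃)`, so `ℓ(u₁) > 0 > ℓ(u₅)`, so the extreme walls `w(u₁), w(u₅)` are negative, so all eight are;
  `Glam_nonneg_n1two_n3three` — hence `Q₂ + λQ₄ ≥ 0` there (vacuously, every `λ`).
* `no_config_222_of_Q4_neg` — the pattern (2,2,2) carries no such configuration with `Q₄ < 0` (negative slope: `w(u₁), w(u₂) < 0`; a
  nonnegative top wall forces a triple intersection `u₃ = u₄ = u₅` right of all roots of `P`, contradicting `lineId_dd`);
  `Glam_nonneg_222`, `Glam_nonneg_333` — with pv2-g15's `conjectureN_53_of_Q4_nonneg`, `Q₂ + λQ₄ ≥ 0` for every `λ ≥ 0` on the patterns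
  (2,2,2) and (by the reflection `u ↦ −u`) (3,3,3).
Pure algebra; nothing here is a case of HC, a rung or a door edge; no statement of Markman's papers is used. New cell result ⇒ Summits/.
-/

set_option linter.dupNamespace false

open Summit.HodgeConjecture.HodgeConjecture.WeilClassTestFormatFiveThreeQ2
open Summit.HodgeConjecture.HodgeConjecture.WeilClassTestFormatFiveThreeLineQuintic

namespace Summit.HodgeConjecture.HodgeConjecture.WeilClassTestFormatFiveThreeEmptyPatterns

set_option maxHeartbeats 800000 in
/-- THE PATTERNS WITH `n₁ = 2`, `n₃ = 3` ARE EMPTY: no centred (5,3) configuration with `P2 = P4 = 0`, pairwise ample, has sorted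
charges `u₁ ≤ u₂ < v₁ ≤ v₂ ≤ v₃`, `v₁ < u₃ < v₃ < u₄ ≤ u₅` (two E-charges below all F-charges, one strictly between `v₁` and `v₃`, two above;
`v₂` anywhere in `[v₁, v₃]`: patterns (2,2,3) and (2,3,3)). Proof: `ℓ(v₁) = K₀(1) > 0 > K₀(3) = ℓ(v₃)`, so the line is positive at `u₁`
and negative at `u₅`; the wall values give `w(u₁) < 0`, `w(u₅) < 0`, hence all walls are negative; `no_config_of_walls_neg`. (P1 is not used.) -/
theorem no_config_n1two_n3three (A₁ A₂ A₃ A₄ A₅ B₁ B₂ B₃ u₁ u₂ u₃ u₄ u₅ v₁ v₂ v₃ : ℝ)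
    (hA : A₁ + A₂ + A₃ + A₄ + A₅ = B₁ + B₂ + B₃) (hC : u₁ + u₂ + u₃ + u₄ + u₅ = v₁ + v₂ + v₃)
    (hP2 : (A₁ * u₁ ^ 2 + A₂ * u₂ ^ 2 + A₃ * u₃ ^ 2 + A₄ * u₄ ^ 2 + A₅ * u₅ ^ 2) - (B₁ * v₁ ^ 2 + B₂ * v₂ ^ 2 + B₃ * v₃ ^ 2) = 0)
    (hP4 : (u₁ ^ 3 + u₂ ^ 3 + u₃ ^ 3 + u₄ ^ 3 + u₅ ^ 3) - (v₁ ^ 3 + v₂ ^ 3 + v₃ ^ 3) = 0)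
    (m₁₁ : |u₁ - v₁| ≤ A₁ - B₁) (m₂₁ : |u₂ - v₁| ≤ A₂ - B₁) (m₃₁ : |u₃ - v₁| ≤ A₃ - B₁) (m₄₁ : |u₄ - v₁| ≤ A₄ - B₁) (m₅₁ : |u₅ - v₁| ≤ A₅ - B₁)
    (m₁₂ : |u₁ - v₂| ≤ A₁ - B₂) (m₂₂ : |u₂ - v₂| ≤ A₂ - B₂) (m₃₂ : |u₃ - v₂| ≤ A₃ - B₂) (m₄₂ : |u₄ - v₂| ≤ A₄ - B₂) (m₅₂ : |u₅ - v₂| ≤ A₅ - B₂)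
    (m₁₃ : |u₁ - v₃| ≤ A₁ - B₃) (m₂₃ : |u₂ - v₃| ≤ A₂ - B₃) (m₃₃ : |u₃ - v₃| ≤ A₃ - B₃) (m₄₃ : |u₄ - v₃| ≤ A₄ - B₃) (m₅₃ : |u₅ - v₃| ≤ A₅ - B₃)
    (h₁₂ : u₁ ≤ u₂) (h₂ : u₂ < v₁) (hv₁₂ : v₁ ≤ v₂) (hv₂₃ : v₂ ≤ v₃) (h₃ : v₁ < u₃) (h₃' : u₃ < v₃) (h₄ : v₃ < u₄) (h₄₅ : u₄ ≤ u₅) :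
    False := by
  -- signs of K₀(1), K₀(3)
  have a₁ : u₁ - v₁ < 0 := by linarith
  have a₂ : u₂ - v₁ < 0 := by linarith
  have a₃ : 0 < u₃ - v₁ := by linarith
  have a₄ : 0 < u₄ - v₁ := by linarith
  have a₅ : 0 < u₅ - v₁ := by linarith
  have hK1 : 0 < (u₁ - v₁) * (u₂ - v₁) * (u₃ - v₁) * (u₄ - v₁) * (u₅ - v₁) :=
    mul_pos (mul_pos (mul_pos (mul_pos_of_neg_of_neg a₁ a₂) a₃) a₄) a₅
  have b₁ : u₁ - v₃ < 0 := by linarith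
  have b₂ : u₂ - v₃ < 0 := by linarith
  have b₃ : u₃ - v₃ < 0 := by linarith
  have b₄ : 0 < u₄ - v₃ := by linarith
  have b₅ : 0 < u₅ - v₃ := by linarith
  have hK3 : (u₁ - v₃) * (u₂ - v₃) * (u₃ - v₃) * (u₄ - v₃) * (u₅ - v₃) < 0 :=
    mul_neg_of_neg_of_pos (mul_neg_of_neg_of_pos (mul_neg_of_pos_of_neg (mul_pos_of_neg_of_neg b₁ b₂) b₃) b₄) b₅
  have hl1 := K0_eq_line₁ u₁ u₂ u₃ u₄ u₅ v₁ v₂ v₃ hC hP4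
  have hl3 := K0_eq_line₃ u₁ u₂ u₃ u₄ u₅ v₁ v₂ v₃ hC hP4
  have hδ : (0:ℝ) < v₃ - v₁ := by linarith
  -- the line at u₁ and at u₅
  have e1 : (v₃ - v₁) * (((u₁ * u₂ * u₃ * u₄ * u₅) + (v₁ * v₂ * v₃) * ((u₁ ^ 2 + u₂ ^ 2 + u₃ ^ 2 + u₄ ^ 2 + u₅ ^ 2) - (v₁ ^ 2 + v₂ ^ 2 + v₃ ^ 2)) / 2) + (-((u₁ * u₂ * u₃ * u₄ + u₁ * u₂ * u₃ * u₅ + u₁ * u₂ * u₄ * u₅ + u₁ * u₃ * u₄ * u₅ + u₂ * u₃ * u₄ * u₅) + (v₁ * v₂ + v₁ * v₃ + v₂ * v₃) * ((u₁ ^ 2 + u₂ ^ 2 + u₃ ^ 2 + u₄ ^ 2 + u₅ ^ 2) - (v₁ ^ 2 + v₂ ^ 2 + v₃ ^ 2)) / 2)) * u₁)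
      = (v₃ - u₁) * (((u₁ * u₂ * u₃ * u₄ * u₅) + (v₁ * v₂ * v₃) * ((u₁ ^ 2 + u₂ ^ 2 + u₃ ^ 2 + u₄ ^ 2 + u₅ ^ 2) - (v₁ ^ 2 + v₂ ^ 2 + v₃ ^ 2)) / 2) + (-((u₁ * u₂ * u₃ * u₄ + u₁ * u₂ * u₃ * u₅ + u₁ * u₂ * u₄ * u₅ + u₁ * u₃ * u₄ * u₅ + u₂ * u₃ * u₄ * u₅) + (v₁ * v₂ + v₁ * v₃ + v₂ * v₃) * ((u₁ ^ 2 + u₂ ^ 2 + u₃ ^ 2 + u₄ ^ 2 + u₅ ^ 2) - (v₁ ^ 2 + v₂ ^ 2 + v₃ ^ 2)) / 2)) * v₁)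
        + (u₁ - v₁) * (((u₁ * u₂ * u₃ * u₄ * u₅) + (v₁ * v₂ * v₃) * ((u₁ ^ 2 + u₂ ^ 2 + u₃ ^ 2 + u₄ ^ 2 + u₅ ^ 2) - (v₁ ^ 2 + v₂ ^ 2 + v₃ ^ 2)) / 2) + (-((u₁ * u₂ * u₃ * u₄ + u₁ * u₂ * u₃ * u₅ + u₁ * u₂ * u₄ * u₅ + u₁ * u₃ * u₄ * u₅ + u₂ * u₃ * u₄ * u₅) + (v₁ * v₂ + v₁ * v₃ + v₂ * v₃) * ((u₁ ^ 2 + u₂ ^ 2 + u₃ ^ 2 + u₄ ^ 2 + u₅ ^ 2) - (v₁ ^ 2 + v₂ ^ 2 + v₃ ^ 2)) / 2)) * v₃) := by ring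
  have hm1 : 0 < (v₃ - v₁) * (((u₁ * u₂ * u₃ * u₄ * u₅) + (v₁ * v₂ * v₃) * ((u₁ ^ 2 + u₂ ^ 2 + u₃ ^ 2 + u₄ ^ 2 + u₅ ^ 2) - (v₁ ^ 2 + v₂ ^ 2 + v₃ ^ 2)) / 2) + (-((u₁ * u₂ * u₃ * u₄ + u₁ * u₂ * u₃ * u₅ + u₁ * u₂ * u₄ * u₅ + u₁ * u₃ * u₄ * u₅ + u₂ * u₃ * u₄ * u₅) + (v₁ * v₂ + v₁ * v₃ + v₂ * v₃) * ((u₁ ^ 2 + u₂ ^ 2 + u₃ ^ 2 + u₄ ^ 2 + u₅ ^ 2) - (v₁ ^ 2 + v₂ ^ 2 + v₃ ^ 2)) / 2)) * u₁) := by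
    rw [e1, ← hl1, ← hl3]
    exact add_pos (mul_pos (by linarith) hK1) (mul_pos_of_neg_of_neg a₁ hK3)
  have hlu1 : 0 < (((u₁ * u₂ * u₃ * u₄ * u₅) + (v₁ * v₂ * v₃) * ((u₁ ^ 2 + u₂ ^ 2 + u₃ ^ 2 + u₄ ^ 2 + u₅ ^ 2) - (v₁ ^ 2 + v₂ ^ 2 + v₃ ^ 2)) / 2) + (-((u₁ * u₂ * u₃ * u₄ + u₁ * u₂ * u₃ * u₅ + u₁ * u₂ * u₄ * u₅ + u₁ * u₃ * u₄ * u₅ + u₂ * u₃ * u₄ * u₅) + (v₁ * v₂ + v₁ * v₃ + v₂ * v₃) * ((u₁ ^ 2 + u₂ ^ 2 + u₃ ^ 2 + u₄ ^ 2 + u₅ ^ 2) - (v₁ ^ 2 + v₂ ^ 2 + v₃ ^ 2)) / 2)) * u₁) := pos_of_pos_mul _ _ hδ hm1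
  have e5 : (v₃ - v₁) * (((u₁ * u₂ * u₃ * u₄ * u₅) + (v₁ * v₂ * v₃) * ((u₁ ^ 2 + u₂ ^ 2 + u₃ ^ 2 + u₄ ^ 2 + u₅ ^ 2) - (v₁ ^ 2 + v₂ ^ 2 + v₃ ^ 2)) / 2) + (-((u₁ * u₂ * u₃ * u₄ + u₁ * u₂ * u₃ * u₅ + u₁ * u₂ * u₄ * u₅ + u₁ * u₃ * u₄ * u₅ + u₂ * u₃ * u₄ * u₅) + (v₁ * v₂ + v₁ * v₃ + v₂ * v₃) * ((u₁ ^ 2 + u₂ ^ 2 + u₃ ^ 2 + u₄ ^ 2 + u₅ ^ 2) - (v₁ ^ 2 + v₂ ^ 2 + v₃ ^ 2)) / 2)) * u₅)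
      = (v₃ - u₅) * (((u₁ * u₂ * u₃ * u₄ * u₅) + (v₁ * v₂ * v₃) * ((u₁ ^ 2 + u₂ ^ 2 + u₃ ^ 2 + u₄ ^ 2 + u₅ ^ 2) - (v₁ ^ 2 + v₂ ^ 2 + v₃ ^ 2)) / 2) + (-((u₁ * u₂ * u₃ * u₄ + u₁ * u₂ * u₃ * u₅ + u₁ * u₂ * u₄ * u₅ + u₁ * u₃ * u₄ * u₅ + u₂ * u₃ * u₄ * u₅) + (v₁ * v₂ + v₁ * v₃ + v₂ * v₃) * ((u₁ ^ 2 + u₂ ^ 2 + u₃ ^ 2 + u₄ ^ 2 + u₅ ^ 2) - (v₁ ^ 2 + v₂ ^ 2 + v₃ ^ 2)) / 2)) * v₁)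
        + (u₅ - v₁) * (((u₁ * u₂ * u₃ * u₄ * u₅) + (v₁ * v₂ * v₃) * ((u₁ ^ 2 + u₂ ^ 2 + u₃ ^ 2 + u₄ ^ 2 + u₅ ^ 2) - (v₁ ^ 2 + v₂ ^ 2 + v₃ ^ 2)) / 2) + (-((u₁ * u₂ * u₃ * u₄ + u₁ * u₂ * u₃ * u₅ + u₁ * u₂ * u₄ * u₅ + u₁ * u₃ * u₄ * u₅ + u₂ * u₃ * u₄ * u₅) + (v₁ * v₂ + v₁ * v₃ + v₂ * v₃) * ((u₁ ^ 2 + u₂ ^ 2 + u₃ ^ 2 + u₄ ^ 2 + u₅ ^ 2) - (v₁ ^ 2 + v₂ ^ 2 + v₃ ^ 2)) / 2)) * v₃) := by ring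
  have hm5 : (v₃ - v₁) * (((u₁ * u₂ * u₃ * u₄ * u₅) + (v₁ * v₂ * v₃) * ((u₁ ^ 2 + u₂ ^ 2 + u₃ ^ 2 + u₄ ^ 2 + u₅ ^ 2) - (v₁ ^ 2 + v₂ ^ 2 + v₃ ^ 2)) / 2) + (-((u₁ * u₂ * u₃ * u₄ + u₁ * u₂ * u₃ * u₅ + u₁ * u₂ * u₄ * u₅ + u₁ * u₃ * u₄ * u₅ + u₂ * u₃ * u₄ * u₅) + (v₁ * v₂ + v₁ * v₃ + v₂ * v₃) * ((u₁ ^ 2 + u₂ ^ 2 + u₃ ^ 2 + u₄ ^ 2 + u₅ ^ 2) - (v₁ ^ 2 + v₂ ^ 2 + v₃ ^ 2)) / 2)) * u₅) < 0 := by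
    rw [e5, ← hl1, ← hl3]
    have t1 : (v₃ - u₅) * ((u₁ - v₁) * (u₂ - v₁) * (u₃ - v₁) * (u₄ - v₁) * (u₅ - v₁)) < 0 := mul_neg_of_neg_of_pos (by linarith) hK1
    have t2 : (u₅ - v₁) * ((u₁ - v₃) * (u₂ - v₃) * (u₃ - v₃) * (u₄ - v₃) * (u₅ - v₃)) < 0 := mul_neg_of_pos_of_neg a₅ hK3
    linarith only [t1, t2]
  have hlu5 : (((u₁ * u₂ * u₃ * u₄ * u₅) + (v₁ * v₂ * v₃) * ((u₁ ^ 2 + u₂ ^ 2 + u₃ ^ 2 + u₄ ^ 2 + u₅ ^ 2) - (v₁ ^ 2 + v₂ ^ 2 + v₃ ^ 2)) / 2) + (-((u₁ * u₂ * u₃ * u₄ + u₁ * u₂ * u₃ * u₅ + u₁ * u₂ * u₄ * u₅ + u₁ * u₃ * u₄ * u₅ + u₂ * u₃ * u₄ * u₅) + (v₁ * v₂ + v₁ * v₃ + v₂ * v₃) * ((u₁ ^ 2 + u₂ ^ 2 + u₃ ^ 2 + u₄ ^ 2 + u₅ ^ 2) - (v₁ ^ 2 + v₂ ^ 2 + v₃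 ^ 2)) / 2)) * u₅) < 0 := neg_of_pos_mul_neg _ _ hδ hm5
  -- walls of u₁ and u₅
  have hC1 : ((u₁ - v₁) * (u₁ - v₂) * (u₁ - v₃)) < 0 := by
    have c2 : u₁ - v₂ < 0 := by linarith
    exact mul_neg_of_pos_of_neg (mul_pos_of_neg_of_neg a₁ c2) b₁
  have hC5 : 0 < ((u₅ - v₁) * (u₅ - v₂) * (u₅ - v₃)) := by
    have c2 : 0 < u₅ - v₂ := by linarith
    exact mul_pos (mul_pos a₅ c2) b₅
  have hw1eq := wall_eq_line₁ u₁ u₂ u₃ u₄ u₅ v₁ v₂ v₃ hC hP4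
  have hw5eq := wall_eq_line₅ u₁ u₂ u₃ u₄ u₅ v₁ v₂ v₃ hC hP4
  have hw₁ : (u₁ ^ 2 - ((u₁ ^ 2 + u₂ ^ 2 + u₃ ^ 2 + u₄ ^ 2 + u₅ ^ 2) - (v₁ ^ 2 + v₂ ^ 2 + v₃ ^ 2)) / 2) < 0 := by
    have h : 0 < (u₁ ^ 2 - ((u₁ ^ 2 + u₂ ^ 2 + u₃ ^ 2 + u₄ ^ 2 + u₅ ^ 2) - (v₁ ^ 2 + v₂ ^ 2 + v₃ ^ 2)) / 2) * ((u₁ - v₁) * (u₁ - v₂) * (u₁ - v₃)) := by rw [hw1eq]; exact hlu1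
    exact neg_of_mul_pos_of_neg _ _ h hC1
  have hw₅ : (u₅ ^ 2 - ((u₁ ^ 2 + u₂ ^ 2 + u₃ ^ 2 + u₄ ^ 2 + u₅ ^ 2) - (v₁ ^ 2 + v₂ ^ 2 + v₃ ^ 2)) / 2) < 0 := by
    have h : (u₅ ^ 2 - ((u₁ ^ 2 + u₂ ^ 2 + u₃ ^ 2 + u₄ ^ 2 + u₅ ^ 2) - (v₁ ^ 2 + v₂ ^ 2 + v₃ ^ 2)) / 2) * ((u₅ - v₁) * (u₅ - v₂) * (u₅ - v₃)) < 0 := by rw [hw5eq]; exact hlu5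
    exact neg_of_mul_neg_of_pos _ _ h hC5
  have hw₂ : (u₂ ^ 2 - ((u₁ ^ 2 + u₂ ^ 2 + u₃ ^ 2 + u₄ ^ 2 + u₅ ^ 2) - (v₁ ^ 2 + v₂ ^ 2 + v₃ ^ 2)) / 2) < 0 := wall_neg_between u₁ u₂ u₅ _ h₁₂ (by linarith) hw₁ hw₅
  have hw₃ : (u₃ ^ 2 - ((u₁ ^ 2 + u₂ ^ 2 + u₃ ^ 2 + u₄ ^ 2 + u₅ ^ 2) - (v₁ ^ 2 + v₂ ^ 2 + v₃ ^ 2)) / 2) < 0 := wall_neg_between u₁ u₃ u₅ _ (by linarith) (by linarith) hw₁ hw₅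
  have hw₄ : (u₄ ^ 2 - ((u₁ ^ 2 + u₂ ^ 2 + u₃ ^ 2 + u₄ ^ 2 + u₅ ^ 2) - (v₁ ^ 2 + v₂ ^ 2 + v₃ ^ 2)) / 2) < 0 := wall_neg_between u₁ u₄ u₅ _ (by linarith) h₄₅ hw₁ hw₅
  have hz₁ : (v₁ ^ 2 - ((u₁ ^ 2 + u₂ ^ 2 + u₃ ^ 2 + u₄ ^ 2 + u₅ ^ 2) - (v₁ ^ 2 + v₂ ^ 2 + v₃ ^ 2)) / 2) < 0 := wall_neg_between u₁ v₁ u₅ _ (by linarith) (by linarith) hw₁ hw₅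
  have hz₂ : (v₂ ^ 2 - ((u₁ ^ 2 + u₂ ^ 2 + u₃ ^ 2 + u₄ ^ 2 + u₅ ^ 2) - (v₁ ^ 2 + v₂ ^ 2 + v₃ ^ 2)) / 2) < 0 := wall_neg_between u₁ v₂ u₅ _ (by linarith) (by linarith) hw₁ hw₅
  have hz₃ : (v₃ ^ 2 - ((u₁ ^ 2 + u₂ ^ 2 + u₃ ^ 2 + u₄ ^ 2 + u₅ ^ 2) - (v₁ ^ 2 + v₂ ^ 2 + v₃ ^ 2)) / 2) < 0 := wall_neg_between u₁ v₃ u₅ _ (by linarith) (by linarith) hw₁ hw₅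
  exact no_config_of_walls_neg A₁ A₂ A₃ A₄ A₅ B₁ B₂ B₃ u₁ u₂ u₃ u₄ u₅ v₁ v₂ v₃ hA hP2 m₁₁ m₂₁ m₃₁ m₄₁ m₅₁ m₁₂ m₂₂ m₃₂ m₄₂ m₅₂ m₁₃ m₂₃ m₃₃ m₄₃ m₅₃ hw₁ hw₂ hw₃ hw₄ hw₅ hz₁ hz₂ hz₃

/-- REAL CONJECTURE N ON THE PATTERNS (2,2,3), (2,3,3) (vacuously, every `λ`): see `no_config_n1two_n3three`. -/
theorem Glam_nonneg_n1two_n3three (A₁ A₂ A₃ A₄ A₅ B₁ B₂ B₃ u₁ u₂ u₃ u₄ u₅ v₁ v₂ v₃ : ℝ)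
    (hA : A₁ + A₂ + A₃ + A₄ + A₅ = B₁ + B₂ + B₃) (hC : u₁ + u₂ + u₃ + u₄ + u₅ = v₁ + v₂ + v₃)
    (hP2 : (A₁ * u₁ ^ 2 + A₂ * u₂ ^ 2 + A₃ * u₃ ^ 2 + A₄ * u₄ ^ 2 + A₅ * u₅ ^ 2) - (B₁ * v₁ ^ 2 + B₂ * v₂ ^ 2 + B₃ * v₃ ^ 2) = 0)
    (hP4 : (u₁ ^ 3 + u₂ ^ 3 + u₃ ^ 3 + u₄ ^ 3 + u₅ ^ 3) - (v₁ ^ 3 + v₂ ^ 3 + v₃ ^ 3) = 0)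
    (m₁₁ : |u₁ - v₁| ≤ A₁ - B₁) (m₂₁ : |u₂ - v₁| ≤ A₂ - B₁) (m₃₁ : |u₃ - v₁| ≤ A₃ - B₁) (m₄₁ : |u₄ - v₁| ≤ A₄ - B₁) (m₅₁ : |u₅ - v₁| ≤ A₅ - B₁)
    (m₁₂ : |u₁ - v₂| ≤ A₁ - B₂) (m₂₂ : |u₂ - v₂| ≤ A₂ - B₂) (m₃₂ : |u₃ - v₂| ≤ A₃ - B₂) (m₄₂ : |u₄ - v₂| ≤ A₄ - B₂) (m₅₂ : |u₅ - v₂| ≤ A₅ - B₂)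
    (m₁₃ : |u₁ - v₃| ≤ A₁ - B₃) (m₂₃ : |u₂ - v₃| ≤ A₂ - B₃) (m₃₃ : |u₃ - v₃| ≤ A₃ - B₃) (m₄₃ : |u₄ - v₃| ≤ A₄ - B₃) (m₅₃ : |u₅ - v₃| ≤ A₅ - B₃)
    (h₁₂ : u₁ ≤ u₂) (h₂ : u₂ < v₁) (hv₁₂ : v₁ ≤ v₂) (hv₂₃ : v₂ ≤ v₃) (h₃ : v₁ < u₃) (h₃' : u₃ < v₃) (h₄ : v₃ < u₄) (h₄₅ : u₄ ≤ u₅)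
    (l : ℝ) :
    0 ≤ (1 / 2) * ((A₁ ^ 2 + A₂ ^ 2 + A₃ ^ 2 + A₄ ^ 2 + A₅ ^ 2) - (B₁ ^ 2 + B₂ ^ 2 + B₃ ^ 2)) * ((u₁ ^ 2 + u₂ ^ 2 + u₃ ^ 2 + u₄ ^ 2 + u₅ ^ 2) - (v₁ ^ 2 + v₂ ^ 2 + v₃ ^ 2))
        + ((A₁ * u₁ + A₂ * u₂ + A₃ * u₃ + A₄ * u₄ + A₅ * u₅) - (B₁ * v₁ + B₂ * v₂ + B₃ * v₃)) ^ 2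
        - 3 * ((A₁ ^ 2 * u₁ ^ 2 + A₂ ^ 2 * u₂ ^ 2 + A₃ ^ 2 * u₃ ^ 2 + A₄ ^ 2 * u₄ ^ 2 + A₅ ^ 2 * u₅ ^ 2) - (B₁ ^ 2 * v₁ ^ 2 + B₂ ^ 2 * v₂ ^ 2 + B₃ ^ 2 * v₃ ^ 2))
      + l * (3 * ((u₁ ^ 4 + u₂ ^ 4 + u₃ ^ 4 + u₄ ^ 4 + u₅ ^ 4) - (v₁ ^ 4 + v₂ ^ 4 + v₃ ^ 4)) - (3 / 2) * ((u₁ ^ 2 + u₂ ^ 2 + u₃ ^ 2 + u₄ ^ 2 + u₅ ^ 2) - (v₁ ^ 2 + v₂ ^ 2 + v₃ ^ 2)) ^ 2) :=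
  (no_config_n1two_n3three A₁ A₂ A₃ A₄ A₅ B₁ B₂ B₃ u₁ u₂ u₃ u₄ u₅ v₁ v₂ v₃ hA hC hP2 hP4 m₁₁ m₂₁ m₃₁ m₄₁ m₅₁ m₁₂ m₂₂ m₃₂ m₄₂ m₅₂ m₁₃ m₂₃ m₃₃ m₄₃ m₅₃ h₁₂ h₂ hv₁₂ hv₂₃ h₃ h₃' h₄ h₄₅).elim

set_option maxHeartbeats 800000 in
/-- THE PATTERN (2,2,2) CARRIES NO CONFIGURATION WITH `Q₄ < 0`: no centred (5,3) configuration with `P2 = P4 = 0`, pairwise ample,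
`Q₄ < 0` and sorted charges `u₁ ≤ u₂ < v₁ ≤ v₂ ≤ v₃ < u₃ ≤ u₄ ≤ u₅`. Proof: the slope `Q₄/12` of `ℓ` is negative and `ℓ(v₁) = K₀(1) > 0`,
so `ℓ(u₁), ℓ(u₂) > 0` and the walls `w(u₁), w(u₂)` are negative. If `w(u₅) ≥ 0` then `ℓ(u₅) ≥ 0`, hence `ℓ(u₃) ≥ 0`, `w(u₃) ≥ 0`, `u₃ > 0`,
and `t ↦ w(t)·∏(t − v_g)` is nondecreasing from `u₃` to `u₅` while `ℓ` decreases: `u₃ = u₄ = u₅`, a triple intersection, where `lineId_dd`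
gives `P''(u₃) = 0 < P''(u₃)`. So `w(u₅) < 0`, all walls are negative, `no_config_of_walls_neg`. -/
theorem no_config_222_of_Q4_neg (A₁ A₂ A₃ A₄ A₅ B₁ B₂ B₃ u₁ u₂ u₃ u₄ u₅ v₁ v₂ v₃ : ℝ)
    (hA : A₁ + A₂ + A₃ + A₄ + A₅ = B₁ + B₂ + B₃) (hC : u₁ + u₂ + u₃ + u₄ + u₅ = v₁ + v₂ + v₃)
    (hP2 : (A₁ * u₁ ^ 2 + A₂ * u₂ ^ 2 + A₃ * u₃ ^ 2 + A₄ * u₄ ^ 2 + A₅ * u₅ ^ 2) - (B₁ * v₁ ^ 2 + B₂ * v₂ ^ 2 + B₃ * v₃ ^ 2) = 0)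
    (hP4 : (u₁ ^ 3 + u₂ ^ 3 + u₃ ^ 3 + u₄ ^ 3 + u₅ ^ 3) - (v₁ ^ 3 + v₂ ^ 3 + v₃ ^ 3) = 0)
    (m₁₁ : |u₁ - v₁| ≤ A₁ - B₁) (m₂₁ : |u₂ - v₁| ≤ A₂ - B₁) (m₃₁ : |u₃ - v₁| ≤ A₃ - B₁) (m₄₁ : |u₄ - v₁| ≤ A₄ - B₁) (m₅₁ : |u₅ - v₁| ≤ A₅ - B₁)
    (m₁₂ : |u₁ - v₂| ≤ A₁ - B₂) (m₂₂ : |u₂ - v₂| ≤ A₂ - B₂) (m₃₂ : |u₃ - v₂| ≤ A₃ - B₂) (m₄₂ : |u₄ - v₂| ≤ A₄ - B₂) (m₅₂ : |u₅ - v₂| ≤ A₅ - B₂)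
    (m₁₃ : |u₁ - v₃| ≤ A₁ - B₃) (m₂₃ : |u₂ - v₃| ≤ A₂ - B₃) (m₃₃ : |u₃ - v₃| ≤ A₃ - B₃) (m₄₃ : |u₄ - v₃| ≤ A₄ - B₃) (m₅₃ : |u₅ - v₃| ≤ A₅ - B₃)
    (h₁₂ : u₁ ≤ u₂) (h₂ : u₂ < v₁) (hv₁₂ : v₁ ≤ v₂) (hv₂₃ : v₂ ≤ v₃) (h₃ : v₃ < u₃) (h₃₄ : u₃ ≤ u₄) (h₄₅ : u₄ ≤ u₅)
    (hQ4 : 3 * ((u₁ ^ 4 + u₂ ^ 4 + u₃ ^ 4 + u₄ ^ 4 + u₅ ^ 4) - (v₁ ^ 4 + v₂ ^ 4 + v₃ ^ 4)) - (3 / 2) * ((u₁ ^ 2 + u₂ ^ 2 + u₃ ^ 2 + u₄ ^ 2 + u₅ ^ 2) - (v₁ ^ 2 + v₂ ^ 2 + v₃ ^ 2)) ^ 2 < 0) :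
    False := by
  -- the slope is negative
  have hσ : (-((u₁ * u₂ * u₃ * u₄ + u₁ * u₂ * u₃ * u₅ + u₁ * u₂ * u₄ * u₅ + u₁ * u₃ * u₄ * u₅ + u₂ * u₃ * u₄ * u₅) + (v₁ * v₂ + v₁ * v₃ + v₂ * v₃) * ((u₁ ^ 2 + u₂ ^ 2 + u₃ ^ 2 + u₄ ^ 2 + u₅ ^ 2) - (v₁ ^ 2 + v₂ ^ 2 + v₃ ^ 2)) / 2)) < 0 := by
    have e := Q4_eq_slope u₁ u₂ u₃ u₄ u₅ v₁ v₂ v₃ hC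
    rw [hP4] at e
    linarith only [e, hQ4]
  -- K₀(1) > 0
  have a₁ : u₁ - v₁ < 0 := by linarith
  have a₂ : u₂ - v₁ < 0 := by linarith
  have a₃ : 0 < u₃ - v₁ := by linarith
  have a₄ : 0 < u₄ - v₁ := by linarith
  have a₅ : 0 < u₅ - v₁ := by linarith
  have hK1 : 0 < (u₁ - v₁) * (u₂ - v₁) * (u₃ - v₁) * (u₄ - v₁) * (u₅ - v₁) :=
    mul_pos (mul_pos (mul_pos (mul_pos_of_neg_of_neg a₁ a₂) a₃) a₄) a₅
  have hl1 := K0_eq_line₁ u₁ u₂ u₃ u₄ u₅ v₁ v₂ v₃ hC hP4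
  -- ℓ(u₁), ℓ(u₂) > 0
  have e1 : (((u₁ * u₂ * u₃ * u₄ * u₅) + (v₁ * v₂ * v₃) * ((u₁ ^ 2 + u₂ ^ 2 + u₃ ^ 2 + u₄ ^ 2 + u₅ ^ 2) - (v₁ ^ 2 + v₂ ^ 2 + v₃ ^ 2)) / 2) + (-((u₁ * u₂ * u₃ * u₄ + u₁ * u₂ * u₃ * u₅ + u₁ * u₂ * u₄ * u₅ + u₁ * u₃ * u₄ * u₅ + u₂ * u₃ * u₄ * u₅) + (v₁ * v₂ + v₁ * v₃ + v₂ * v₃) * ((u₁ ^ 2 + u₂ ^ 2 + u₃ ^ 2 + u₄ ^ 2 + u₅ ^ 2) - (v₁ ^ 2 + v₂ ^ 2 + v₃ ^ 2)) / 2)) * u₁)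
      = (((u₁ * u₂ * u₃ * u₄ * u₅) + (v₁ * v₂ * v₃) * ((u₁ ^ 2 + u₂ ^ 2 + u₃ ^ 2 + u₄ ^ 2 + u₅ ^ 2) - (v₁ ^ 2 + v₂ ^ 2 + v₃ ^ 2)) / 2) + (-((u₁ * u₂ * u₃ * u₄ + u₁ * u₂ * u₃ * u₅ + u₁ * u₂ * u₄ * u₅ + u₁ * u₃ * u₄ * u₅ + u₂ * u₃ * u₄ * u₅) + (v₁ * v₂ + v₁ * v₃ + v₂ * v₃) * ((u₁ ^ 2 + u₂ ^ 2 + u₃ ^ 2 + u₄ ^ 2 + u₅ ^ 2) - (v₁ ^ 2 + v₂ ^ 2 + v₃ ^ 2)) / 2)) * v₁) + (-((u₁ * u₂ * u₃ * u₄ + u₁ * u₂ * u₃ * u₅ + u₁ * u₂ * u₄ * u₅ + u₁ * u₃ * u₄ * u₅ + u₂ * u₃ * u₄ * u₅) + (v₁ * v₂ + v₁ * v₃ + v₂ * v₃) * ((u₁ ^ 2 + u₂ ^ 2 + u₃ ^ 2 + u₄ ^ 2 + u₅ ^ 2) - (v₁ ^ 2 + v₂ ^ 2 + v₃ ^ 2))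 / 2)) * (u₁ - v₁) := by ring
  have hlu1 : 0 < (((u₁ * u₂ * u₃ * u₄ * u₅) + (v₁ * v₂ * v₃) * ((u₁ ^ 2 + u₂ ^ 2 + u₃ ^ 2 + u₄ ^ 2 + u₅ ^ 2) - (v₁ ^ 2 + v₂ ^ 2 + v₃ ^ 2)) / 2) + (-((u₁ * u₂ * u₃ * u₄ + u₁ * u₂ * u₃ * u₅ + u₁ * u₂ * u₄ * u₅ + u₁ * u₃ * u₄ * u₅ + u₂ * u₃ * u₄ * u₅) + (v₁ * v₂ + v₁ * v₃ + v₂ * v₃) * ((u₁ ^ 2 + u₂ ^ 2 + u₃ ^ 2 + u₄ ^ 2 + u₅ ^ 2) - (v₁ ^ 2 + v₂ ^ 2 + v₃ ^ 2)) / 2)) * u₁) := by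
    rw [e1, ← hl1]; exact add_pos hK1 (mul_pos_of_neg_of_neg hσ a₁)
  have e2 : (((u₁ * u₂ * u₃ * u₄ * u₅) + (v₁ * v₂ * v₃) * ((u₁ ^ 2 + u₂ ^ 2 + u₃ ^ 2 + u₄ ^ 2 + u₅ ^ 2) - (v₁ ^ 2 + v₂ ^ 2 + v₃ ^ 2)) / 2) + (-((u₁ * u₂ * u₃ * u₄ + u₁ * u₂ * u₃ * u₅ + u₁ * u₂ * u₄ * u₅ + u₁ * u₃ * u₄ * u₅ + u₂ * u₃ * u₄ * u₅) + (v₁ * v₂ + v₁ * v₃ + v₂ * v₃) * ((u₁ ^ 2 + u₂ ^ 2 + u₃ ^ 2 + u₄ ^ 2 + u₅ ^ 2) - (v₁ ^ 2 + v₂ ^ 2 + v₃ ^ 2)) / 2)) * u₂)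
      = (((u₁ * u₂ * u₃ * u₄ * u₅) + (v₁ * v₂ * v₃) * ((u₁ ^ 2 + u₂ ^ 2 + u₃ ^ 2 + u₄ ^ 2 + u₅ ^ 2) - (v₁ ^ 2 + v₂ ^ 2 + v₃ ^ 2)) / 2) + (-((u₁ * u₂ * u₃ * u₄ + u₁ * u₂ * u₃ * u₅ + u₁ * u₂ * u₄ * u₅ + u₁ * u₃ * u₄ * u₅ + u₂ * u₃ * u₄ * u₅) + (v₁ * v₂ + v₁ * v₃ + v₂ * v₃) * ((u₁ ^ 2 + u₂ ^ 2 + u₃ ^ 2 + u₄ ^ 2 + u₅ ^ 2) - (v₁ ^ 2 + v₂ ^ 2 + v₃ ^ 2)) / 2)) * v₁) + (-((u₁ * u₂ * u₃ * u₄ + u₁ * u₂ * u₃ * u₅ + u₁ * u₂ * u₄ * u₅ + u₁ * u₃ * u₄ * u₅ + u₂ * u₃ * u₄ * u₅) + (v₁ * v₂ + v₁ * v₃ + v₂ * v₃) * ((u₁ ^ 2 + u₂ ^ 2 + u₃ ^ 2 + u₄ ^ 2 + u₅ ^ 2) - (v₁ ^ 2 + v₂ ^ 2 + v₃ ^ 2))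 / 2)) * (u₂ - v₁) := by ring
  have hlu2 : 0 < (((u₁ * u₂ * u₃ * u₄ * u₅) + (v₁ * v₂ * v₃) * ((u₁ ^ 2 + u₂ ^ 2 + u₃ ^ 2 + u₄ ^ 2 + u₅ ^ 2) - (v₁ ^ 2 + v₂ ^ 2 + v₃ ^ 2)) / 2) + (-((u₁ * u₂ * u₃ * u₄ + u₁ * u₂ * u₃ * u₅ + u₁ * u₂ * u₄ * u₅ + u₁ * u₃ * u₄ * u₅ + u₂ * u₃ * u₄ * u₅) + (v₁ * v₂ + v₁ * v₃ + v₂ * v₃) * ((u₁ ^ 2 + u₂ ^ 2 + u₃ ^ 2 + u₄ ^ 2 + u₅ ^ 2) - (v₁ ^ 2 + v₂ ^ 2 + v₃ ^ 2)) / 2)) * u₂) := by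
    rw [e2, ← hl1]; exact add_pos hK1 (mul_pos_of_neg_of_neg hσ a₂)
  -- walls of u₁, u₂ negative
  have b₁ : u₁ - v₃ < 0 := by linarith
  have b₂ : u₂ - v₃ < 0 := by linarith
  have hC1 : ((u₁ - v₁) * (u₁ - v₂) * (u₁ - v₃)) < 0 := by
    have c2 : u₁ - v₂ < 0 := by linarith
    exact mul_neg_of_pos_of_neg (mul_pos_of_neg_of_neg a₁ c2) b₁
  have hC2 : ((u₂ - v₁) * (u₂ - v₂) * (u₂ - v₃)) < 0 := by
    have c2 : u₂ - v₂ < 0 := by linarith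
    exact mul_neg_of_pos_of_neg (mul_pos_of_neg_of_neg a₂ c2) b₂
  have hw1eq := wall_eq_line₁ u₁ u₂ u₃ u₄ u₅ v₁ v₂ v₃ hC hP4
  have hw2eq := wall_eq_line₂ u₁ u₂ u₃ u₄ u₅ v₁ v₂ v₃ hC hP4
  have hw3eq := wall_eq_line₃ u₁ u₂ u₃ u₄ u₅ v₁ v₂ v₃ hC hP4
  have hw5eq := wall_eq_line₅ u₁ u₂ u₃ u₄ u₅ v₁ v₂ v₃ hC hP4
  have hw₁ : (u₁ ^ 2 - ((u₁ ^ 2 + u₂ ^ 2 + u₃ ^ 2 + u₄ ^ 2 + u₅ ^ 2) - (v₁ ^ 2 + v₂ ^ 2 + v₃ ^ 2)) / 2) < 0 := by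
    have h : 0 < (u₁ ^ 2 - ((u₁ ^ 2 + u₂ ^ 2 + u₃ ^ 2 + u₄ ^ 2 + u₅ ^ 2) - (v₁ ^ 2 + v₂ ^ 2 + v₃ ^ 2)) / 2) * ((u₁ - v₁) * (u₁ - v₂) * (u₁ - v₃)) := by rw [hw1eq]; exact hlu1
    exact neg_of_mul_pos_of_neg _ _ h hC1
  have hw₂ : (u₂ ^ 2 - ((u₁ ^ 2 + u₂ ^ 2 + u₃ ^ 2 + u₄ ^ 2 + u₅ ^ 2) - (v₁ ^ 2 + v₂ ^ 2 + v₃ ^ 2)) / 2) < 0 := by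
    have h : 0 < (u₂ ^ 2 - ((u₁ ^ 2 + u₂ ^ 2 + u₃ ^ 2 + u₄ ^ 2 + u₅ ^ 2) - (v₁ ^ 2 + v₂ ^ 2 + v₃ ^ 2)) / 2) * ((u₂ - v₁) * (u₂ - v₂) * (u₂ - v₃)) := by rw [hw2eq]; exact hlu2
    exact neg_of_mul_pos_of_neg _ _ h hC2
  -- C(u₃), C(u₅) > 0
  have c₃₁ : 0 < u₃ - v₁ := by linarith
  have c₃₂ : 0 < u₃ - v₂ := by linarith
  have c₃₃ : 0 < u₃ - v₃ := by linarith
  have c₅₁ : 0 < u₅ - v₁ := by linarith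
  have c₅₂ : 0 < u₅ - v₂ := by linarith
  have c₅₃ : 0 < u₅ - v₃ := by linarith
  have hC3 : 0 < ((u₃ - v₁) * (u₃ - v₂) * (u₃ - v₃)) := mul_pos (mul_pos c₃₁ c₃₂) c₃₃
  have hC5 : 0 < ((u₅ - v₁) * (u₅ - v₂) * (u₅ - v₃)) := mul_pos (mul_pos c₅₁ c₅₂) c₅₃
  -- the top wall is negative
  have hw₅ : (u₅ ^ 2 - ((u₁ ^ 2 + u₂ ^ 2 + u₃ ^ 2 + u₄ ^ 2 + u₅ ^ 2) - (v₁ ^ 2 + v₂ ^ 2 + v₃ ^ 2)) / 2) < 0 := by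
    rcases lt_or_ge ((u₅ ^ 2 - ((u₁ ^ 2 + u₂ ^ 2 + u₃ ^ 2 + u₄ ^ 2 + u₅ ^ 2) - (v₁ ^ 2 + v₂ ^ 2 + v₃ ^ 2)) / 2)) 0 with hlt | hcon
    · exact hlt
    exfalso
    -- ℓ(u₅) ≥ 0, ℓ(u₃) ≥ 0, w(u₃) ≥ 0
    have hlu5 : 0 ≤ (((u₁ * u₂ * u₃ * u₄ * u₅) + (v₁ * v₂ * v₃) * ((u₁ ^ 2 + u₂ ^ 2 + u₃ ^ 2 + u₄ ^ 2 + u₅ ^ 2) - (v₁ ^ 2 + v₂ ^ 2 + v₃ ^ 2)) / 2) + (-((u₁ * u₂ * u₃ * u₄ + u₁ * u₂ * u₃ * u₅ + u₁ * u₂ * u₄ * u₅ + u₁ * u₃ * u₄ * u₅ + u₂ * u₃ * u₄ * u₅) + (v₁ * v₂ + v₁ * v₃ + v₂ * v₃) * ((u₁ ^ 2 + u₂ ^ 2 + u₃ ^ 2 + u₄ ^ 2 + u₅ ^ 2) - (v₁ ^ 2 + v₂ ^ 2 + v₃ ^ 2)) / 2)) * u₅) := by rw [← hw5eq]; exact mul_nonneg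 hcon hC5.le
    have e3 : (((u₁ * u₂ * u₃ * u₄ * u₅) + (v₁ * v₂ * v₃) * ((u₁ ^ 2 + u₂ ^ 2 + u₃ ^ 2 + u₄ ^ 2 + u₅ ^ 2) - (v₁ ^ 2 + v₂ ^ 2 + v₃ ^ 2)) / 2) + (-((u₁ * u₂ * u₃ * u₄ + u₁ * u₂ * u₃ * u₅ + u₁ * u₂ * u₄ * u₅ + u₁ * u₃ * u₄ * u₅ + u₂ * u₃ * u₄ * u₅) + (v₁ * v₂ + v₁ * v₃ + v₂ * v₃) * ((u₁ ^ 2 + u₂ ^ 2 + u₃ ^ 2 + u₄ ^ 2 + u₅ ^ 2) - (v₁ ^ 2 + v₂ ^ 2 + v₃ ^ 2)) / 2)) * u₃)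
        = (((u₁ * u₂ * u₃ * u₄ * u₅) + (v₁ * v₂ * v₃) * ((u₁ ^ 2 + u₂ ^ 2 + u₃ ^ 2 + u₄ ^ 2 + u₅ ^ 2) - (v₁ ^ 2 + v₂ ^ 2 + v₃ ^ 2)) / 2) + (-((u₁ * u₂ * u₃ * u₄ + u₁ * u₂ * u₃ * u₅ + u₁ * u₂ * u₄ * u₅ + u₁ * u₃ * u₄ * u₅ + u₂ * u₃ * u₄ * u₅) + (v₁ * v₂ + v₁ * v₃ + v₂ * v₃) * ((u₁ ^ 2 + u₂ ^ 2 + u₃ ^ 2 + u₄ ^ 2 + u₅ ^ 2) - (v₁ ^ 2 + v₂ ^ 2 + v₃ ^ 2)) / 2)) * u₅) + (-((u₁ * u₂ * u₃ * u₄ + u₁ * u₂ * u₃ * u₅ + u₁ * u₂ * u₄ * u₅ + u₁ * u₃ * u₄ * u₅ + u₂ * u₃ * u₄ * u₅) + (v₁ * v₂ + v₁ * v₃ + v₂ * v₃) * ((u₁ ^ 2 + u₂ ^ 2 + u₃ ^ 2 + u₄ ^ 2 + u₅ ^ 2) - (v₁ ^ 2 + v₂ ^ 2 + v₃ ^ 2))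 / 2)) * (u₃ - u₅) := by ring
    have hlu3 : 0 ≤ (((u₁ * u₂ * u₃ * u₄ * u₅) + (v₁ * v₂ * v₃) * ((u₁ ^ 2 + u₂ ^ 2 + u₃ ^ 2 + u₄ ^ 2 + u₅ ^ 2) - (v₁ ^ 2 + v₂ ^ 2 + v₃ ^ 2)) / 2) + (-((u₁ * u₂ * u₃ * u₄ + u₁ * u₂ * u₃ * u₅ + u₁ * u₂ * u₄ * u₅ + u₁ * u₃ * u₄ * u₅ + u₂ * u₃ * u₄ * u₅) + (v₁ * v₂ + v₁ * v₃ + v₂ * v₃) * ((u₁ ^ 2 + u₂ ^ 2 + u₃ ^ 2 + u₄ ^ 2 + u₅ ^ 2) - (v₁ ^ 2 + v₂ ^ 2 + v₃ ^ 2)) / 2)) * u₃) := by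
      rw [e3]; exact add_nonneg hlu5 (mul_nonneg_of_nonpos_nonpos _ _ hσ.le (by linarith only [h₃₄, h₄₅]))
    have hw3 : 0 ≤ (u₃ ^ 2 - ((u₁ ^ 2 + u₂ ^ 2 + u₃ ^ 2 + u₄ ^ 2 + u₅ ^ 2) - (v₁ ^ 2 + v₂ ^ 2 + v₃ ^ 2)) / 2) := by
      have h : 0 ≤ (u₃ ^ 2 - ((u₁ ^ 2 + u₂ ^ 2 + u₃ ^ 2 + u₄ ^ 2 + u₅ ^ 2) - (v₁ ^ 2 + v₂ ^ 2 + v₃ ^ 2)) / 2) * ((u₃ - v₁) * (u₃ - v₂) * (u₃ - v₃)) := by rw [hw3eq]; exact hlu3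
      exact nonneg_of_mul_nonneg_of_pos _ _ h hC3
    -- u₃ > 0 (since w(u₂) < 0 ≤ w(u₃) and u₂ < u₃)
    have hu3 : 0 < u₃ := pos_of_wall_lt u₂ u₃ _ (by linarith only [h₂, hv₁₂, hv₂₃, h₃]) hw₂ hw3
    -- monotonicity: w(u₃)C(u₃) ≤ w(u₅)C(u₅)
    have h35 : u₃ ≤ u₅ := h₃₄.trans h₄₅
    have hW35 : (u₃ ^ 2 - ((u₁ ^ 2 + u₂ ^ 2 + u₃ ^ 2 + u₄ ^ 2 + u₅ ^ 2) - (v₁ ^ 2 + v₂ ^ 2 + v₃ ^ 2)) / 2) ≤ (u₅ ^ 2 - ((u₁ ^ 2 + u₂ ^ 2 + u₃ ^ 2 + u₄ ^ 2 + u₅ ^ 2) - (v₁ ^ 2 + v₂ ^ 2 + v₃ ^ 2)) / 2) := wall_mono u₃ u₅ _ hu3 h35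
    have hC35 : ((u₃ - v₁) * (u₃ - v₂) * (u₃ - v₃)) ≤ ((u₅ - v₁) * (u₅ - v₂) * (u₅ - v₃)) := by
      have f1 : u₃ - v₁ ≤ u₅ - v₁ := by linarith only [h35]
      have f2 : u₃ - v₂ ≤ u₅ - v₂ := by linarith only [h35]
      have f3 : u₃ - v₃ ≤ u₅ - v₃ := by linarith only [h35]
      exact mul_le_mul (mul_le_mul f1 f2 c₃₂.le c₅₁.le) f3 c₃₃.le (mul_nonneg c₅₁.le c₅₂.le)
    have hprod : (u₃ ^ 2 - ((u₁ ^ 2 + u₂ ^ 2 + u₃ ^ 2 + u₄ ^ 2 + u₅ ^ 2) - (v₁ ^ 2 + v₂ ^ 2 + v₃ ^ 2)) / 2) * ((u₃ - v₁) * (u₃ - v₂) * (u₃ - v₃)) ≤ (u₅ ^ 2 - ((u₁ ^ 2 + u₂ ^ 2 + u₃ ^ 2 + u₄ ^ 2 + u₅ ^ 2) - (v₁ ^ 2 + v₂ ^ 2 + v₃ ^ 2)) / 2) * ((u₅ - v₁) * (u₅ - v₂) * (u₅ - v₃)) :=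
      mul_le_mul hW35 hC35 hC3.le hcon
    have hdiff : (-((u₁ * u₂ * u₃ * u₄ + u₁ * u₂ * u₃ * u₅ + u₁ * u₂ * u₄ * u₅ + u₁ * u₃ * u₄ * u₅ + u₂ * u₃ * u₄ * u₅) + (v₁ * v₂ + v₁ * v₃ + v₂ * v₃) * ((u₁ ^ 2 + u₂ ^ 2 + u₃ ^ 2 + u₄ ^ 2 + u₅ ^ 2) - (v₁ ^ 2 + v₂ ^ 2 + v₃ ^ 2)) / 2)) * (u₅ - u₃)
        = (u₅ ^ 2 - ((u₁ ^ 2 + u₂ ^ 2 + u₃ ^ 2 + u₄ ^ 2 + u₅ ^ 2) - (v₁ ^ 2 + v₂ ^ 2 + v₃ ^ 2)) / 2) * ((u₅ - v₁) * (u₅ - v₂) * (u₅ - v₃)) - (u₃ ^ 2 - ((u₁ ^ 2 + u₂ ^ 2 + u₃ ^ 2 + u₄ ^ 2 + u₅ ^ 2) - (v₁ ^ 2 + v₂ ^ 2 + v₃ ^ 2)) / 2) * ((u₃ - v₁) * (u₃ - v₂) * (u₃ - v₃)) := by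
      rw [hw5eq, hw3eq]; ring
    have hsd : 0 ≤ (-((u₁ * u₂ * u₃ * u₄ + u₁ * u₂ * u₃ * u₅ + u₁ * u₂ * u₄ * u₅ + u₁ * u₃ * u₄ * u₅ + u₂ * u₃ * u₄ * u₅) + (v₁ * v₂ + v₁ * v₃ + v₂ * v₃) * ((u₁ ^ 2 + u₂ ^ 2 + u₃ ^ 2 + u₄ ^ 2 + u₅ ^ 2) - (v₁ ^ 2 + v₂ ^ 2 + v₃ ^ 2)) / 2)) * (u₅ - u₃) := by rw [hdiff]; linarith only [hprod]
    have h53 : u₅ - u₃ ≤ 0 := nonpos_of_neg_mul_nonneg _ _ hσ hsd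
    have e43 : u₄ = u₃ := le_antisymm (by linarith only [h53, h₄₅]) h₃₄
    have e53 : u₅ = u₃ := le_antisymm (by linarith only [h53]) h35
    -- triple intersection at u₃: p''(u₃) = 0, so P''(u₃) = 0; but P''(u₃) > 0
    have hdd := lineId_dd u₃ u₁ u₂ u₃ u₄ u₅ v₁ v₂ v₃ hC
    have hp0 : (2 * ((u₃ - u₃) * (u₄ - u₃) * (u₅ - u₃) + (u₂ - u₃) * (u₄ - u₃) * (u₅ - u₃) + (u₂ - u₃) * (u₃ - u₃) * (u₅ - u₃) + (u₂ - u₃) * (u₃ - u₃) * (u₄ - u₃) + (u₁ - u₃) * (u₄ - u₃) * (u₅ - u₃) + (u₁ - u₃) * (u₃ - u₃) * (u₅ - u₃) + (u₁ - u₃) * (u₃ - u₃) * (u₄ - u₃) + (u₁ - u₃) * (u₂ - u₃) * (u₅ - u₃) + (u₁ - u₃) * (u₂ - u₃) * (u₄ - u₃) + (u₁ - u₃) * (u₂ - u₃) * (u₃ - u₃))) = 0 := by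
      rw [e43, e53]; ring
    have hPdd : ((2 * ((u₃ - v₁) + (u₃ - v₂) + (u₃ - v₃))) * (u₃ ^ 2 - ((u₁ ^ 2 + u₂ ^ 2 + u₃ ^ 2 + u₄ ^ 2 + u₅ ^ 2) - (v₁ ^ 2 + v₂ ^ 2 + v₃ ^ 2)) / 2) + 4 * u₃ * ((u₃ - v₂) * (u₃ - v₃) + (u₃ - v₁) * (u₃ - v₃) + (u₃ - v₁) * (u₃ - v₂)) + 2 * ((u₃ - v₁) * (u₃ - v₂) * (u₃ - v₃))) = 0 := by
      linear_combination hdd - hp0 + (2 / 3) * hP4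
    have hpos : 0 < ((2 * ((u₃ - v₁) + (u₃ - v₂) + (u₃ - v₃))) * (u₃ ^ 2 - ((u₁ ^ 2 + u₂ ^ 2 + u₃ ^ 2 + u₄ ^ 2 + u₅ ^ 2) - (v₁ ^ 2 + v₂ ^ 2 + v₃ ^ 2)) / 2) + 4 * u₃ * ((u₃ - v₂) * (u₃ - v₃) + (u₃ - v₁) * (u₃ - v₃) + (u₃ - v₁) * (u₃ - v₂)) + 2 * ((u₃ - v₁) * (u₃ - v₂) * (u₃ - v₃))) := by positivity
    linarith only [hPdd, hpos]
  -- all walls negative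
  have hw₃ : (u₃ ^ 2 - ((u₁ ^ 2 + u₂ ^ 2 + u₃ ^ 2 + u₄ ^ 2 + u₅ ^ 2) - (v₁ ^ 2 + v₂ ^ 2 + v₃ ^ 2)) / 2) < 0 := wall_neg_between u₁ u₃ u₅ _ (by linarith) (by linarith) hw₁ hw₅
  have hw₄ : (u₄ ^ 2 - ((u₁ ^ 2 + u₂ ^ 2 + u₃ ^ 2 + u₄ ^ 2 + u₅ ^ 2) - (v₁ ^ 2 + v₂ ^ 2 + v₃ ^ 2)) / 2) < 0 := wall_neg_between u₁ u₄ u₅ _ (by linarith) h₄₅ hw₁ hw₅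
  have hz₁ : (v₁ ^ 2 - ((u₁ ^ 2 + u₂ ^ 2 + u₃ ^ 2 + u₄ ^ 2 + u₅ ^ 2) - (v₁ ^ 2 + v₂ ^ 2 + v₃ ^ 2)) / 2) < 0 := wall_neg_between u₁ v₁ u₅ _ (by linarith) (by linarith) hw₁ hw₅
  have hz₂ : (v₂ ^ 2 - ((u₁ ^ 2 + u₂ ^ 2 + u₃ ^ 2 + u₄ ^ 2 + u₅ ^ 2) - (v₁ ^ 2 + v₂ ^ 2 + v₃ ^ 2)) / 2) < 0 := wall_neg_between u₁ v₂ u₅ _ (by linarith) (by linarith) hw₁ hw₅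
  have hz₃ : (v₃ ^ 2 - ((u₁ ^ 2 + u₂ ^ 2 + u₃ ^ 2 + u₄ ^ 2 + u₅ ^ 2) - (v₁ ^ 2 + v₂ ^ 2 + v₃ ^ 2)) / 2) < 0 := wall_neg_between u₁ v₃ u₅ _ (by linarith) (by linarith) hw₁ hw₅
  exact no_config_of_walls_neg A₁ A₂ A₃ A₄ A₅ B₁ B₂ B₃ u₁ u₂ u₃ u₄ u₅ v₁ v₂ v₃ hA hP2 m₁₁ m₂₁ m₃₁ m₄₁ m₅₁ m₁₂ m₂₂ m₃₂ m₄₂ m₅₂ m₁₃ m₂₃ m₃₃ m₄₃ m₅₃ hw₁ hw₂ hw₃ hw₄ hw₅ hz₁ hz₂ hz₃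

/-- REAL CONJECTURE N ON THE PATTERN (2,2,2), every `λ ≥ 0`: either `Q₄ ≥ 0` (pv2-g15's `conjectureN_53_of_Q4_nonneg`) or the
configuration does not exist (`no_config_222_of_Q4_neg`). -/
theorem Glam_nonneg_222 (A₁ A₂ A₃ A₄ A₅ B₁ B₂ B₃ u₁ u₂ u₃ u₄ u₅ v₁ v₂ v₃ : ℝ)
    (hA : A₁ + A₂ + A₃ + A₄ + A₅ = B₁ + B₂ + B₃) (hC : u₁ + u₂ + u₃ + u₄ + u₅ = v₁ + v₂ + v₃)
    (hP1 : (A₁ ^ 2 * u₁ + A₂ ^ 2 * u₂ + A₃ ^ 2 * u₃ + A₄ ^ 2 * u₄ + A₅ ^ 2 * u₅) - (B₁ ^ 2 * v₁ + B₂ ^ 2 * v₂ + B₃ ^ 2 * v₃) = 0)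
    (hP2 : (A₁ * u₁ ^ 2 + A₂ * u₂ ^ 2 + A₃ * u₃ ^ 2 + A₄ * u₄ ^ 2 + A₅ * u₅ ^ 2) - (B₁ * v₁ ^ 2 + B₂ * v₂ ^ 2 + B₃ * v₃ ^ 2) = 0)
    (hP4 : (u₁ ^ 3 + u₂ ^ 3 + u₃ ^ 3 + u₄ ^ 3 + u₅ ^ 3) - (v₁ ^ 3 + v₂ ^ 3 + v₃ ^ 3) = 0)
    (m₁₁ : |u₁ - v₁| ≤ A₁ - B₁) (m₂₁ : |u₂ - v₁| ≤ A₂ - B₁) (m₃₁ : |u₃ - v₁| ≤ A₃ - B₁) (m₄₁ : |u₄ - v₁| ≤ A₄ - B₁) (m₅₁ : |u₅ - v₁| ≤ A₅ - B₁)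
    (m₁₂ : |u₁ - v₂| ≤ A₁ - B₂) (m₂₂ : |u₂ - v₂| ≤ A₂ - B₂) (m₃₂ : |u₃ - v₂| ≤ A₃ - B₂) (m₄₂ : |u₄ - v₂| ≤ A₄ - B₂) (m₅₂ : |u₅ - v₂| ≤ A₅ - B₂)
    (m₁₃ : |u₁ - v₃| ≤ A₁ - B₃) (m₂₃ : |u₂ - v₃| ≤ A₂ - B₃) (m₃₃ : |u₃ - v₃| ≤ A₃ - B₃) (m₄₃ : |u₄ - v₃| ≤ A₄ - B₃) (m₅₃ : |u₅ - v₃| ≤ A₅ - B₃)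
    (h₁₂ : u₁ ≤ u₂) (h₂ : u₂ < v₁) (hv₁₂ : v₁ ≤ v₂) (hv₂₃ : v₂ ≤ v₃) (h₃ : v₃ < u₃) (h₃₄ : u₃ ≤ u₄) (h₄₅ : u₄ ≤ u₅)
    (l : ℝ) (hl : 0 ≤ l) :
    0 ≤ (1 / 2) * ((A₁ ^ 2 + A₂ ^ 2 + A₃ ^ 2 + A₄ ^ 2 + A₅ ^ 2) - (B₁ ^ 2 + B₂ ^ 2 + B₃ ^ 2)) * ((u₁ ^ 2 + u₂ ^ 2 + u₃ ^ 2 + u₄ ^ 2 + u₅ ^ 2) - (v₁ ^ 2 + v₂ ^ 2 + v₃ ^ 2))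
        + ((A₁ * u₁ + A₂ * u₂ + A₃ * u₃ + A₄ * u₄ + A₅ * u₅) - (B₁ * v₁ + B₂ * v₂ + B₃ * v₃)) ^ 2
        - 3 * ((A₁ ^ 2 * u₁ ^ 2 + A₂ ^ 2 * u₂ ^ 2 + A₃ ^ 2 * u₃ ^ 2 + A₄ ^ 2 * u₄ ^ 2 + A₅ ^ 2 * u₅ ^ 2) - (B₁ ^ 2 * v₁ ^ 2 + B₂ ^ 2 * v₂ ^ 2 + B₃ ^ 2 * v₃ ^ 2))
      + l * (3 * ((u₁ ^ 4 + u₂ ^ 4 + u₃ ^ 4 + u₄ ^ 4 + u₅ ^ 4) - (v₁ ^ 4 + v₂ ^ 4 + v₃ ^ 4)) - (3 / 2) * ((u₁ ^ 2 + u₂ ^ 2 + u₃ ^ 2 + u₄ ^ 2 + u₅ ^ 2) - (v₁ ^ 2 + v₂ ^ 2 + v₃ ^ 2)) ^ 2) := by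
  rcases le_or_gt 0 (3 * ((u₁ ^ 4 + u₂ ^ 4 + u₃ ^ 4 + u₄ ^ 4 + u₅ ^ 4) - (v₁ ^ 4 + v₂ ^ 4 + v₃ ^ 4)) - (3 / 2) * ((u₁ ^ 2 + u₂ ^ 2 + u₃ ^ 2 + u₄ ^ 2 + u₅ ^ 2) - (v₁ ^ 2 + v₂ ^ 2 + v₃ ^ 2)) ^ 2) with hQ | hQ
  · exact conjectureN_53_of_Q4_nonneg A₁ A₂ A₃ A₄ A₅ B₁ B₂ B₃ u₁ u₂ u₃ u₄ u₅ v₁ v₂ v₃ hA hC hP1 hP2 m₁₁ m₂₁ m₃₁ m₄₁ m₅₁ m₁₂ m₂₂ m₃₂ m₄₂ m₅₂ m₁₃ m₂₃ m₃₃ m₄₃ m₅₃ hQ l hl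
  · exact (no_config_222_of_Q4_neg A₁ A₂ A₃ A₄ A₅ B₁ B₂ B₃ u₁ u₂ u₃ u₄ u₅ v₁ v₂ v₃ hA hC hP2 hP4 m₁₁ m₂₁ m₃₁ m₄₁ m₅₁ m₁₂ m₂₂ m₃₂ m₄₂ m₅₂ m₁₃ m₂₃ m₃₃ m₄₃ m₅₃ h₁₂ h₂ hv₁₂ hv₂₃ h₃ h₃₄ h₄₅ hQ).elim

set_option maxHeartbeats 800000 in
/-- REAL CONJECTURE N ON THE PATTERN (3,3,3), every `λ ≥ 0` (mirror of `Glam_nonneg_222` under `u ↦ −u`, `v ↦ −v`): sorted charges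
`u₁ ≤ u₂ ≤ u₃ < v₁ ≤ v₂ ≤ v₃ < u₄ ≤ u₅`. -/
theorem Glam_nonneg_333 (A₁ A₂ A₃ A₄ A₅ B₁ B₂ B₃ u₁ u₂ u₃ u₄ u₅ v₁ v₂ v₃ : ℝ)
    (hA : A₁ + A₂ + A₃ + A₄ + A₅ = B₁ + B₂ + B₃) (hC : u₁ + u₂ + u₃ + u₄ + u₅ = v₁ + v₂ + v₃)
    (hP1 : (A₁ ^ 2 * u₁ + A₂ ^ 2 * u₂ + A₃ ^ 2 * u₃ + A₄ ^ 2 * u₄ + A₅ ^ 2 * u₅) - (B₁ ^ 2 * v₁ + B₂ ^ 2 * v₂ + B₃ ^ 2 * v₃) = 0)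
    (hP2 : (A₁ * u₁ ^ 2 + A₂ * u₂ ^ 2 + A₃ * u₃ ^ 2 + A₄ * u₄ ^ 2 + A₅ * u₅ ^ 2) - (B₁ * v₁ ^ 2 + B₂ * v₂ ^ 2 + B₃ * v₃ ^ 2) = 0)
    (hP4 : (u₁ ^ 3 + u₂ ^ 3 + u₃ ^ 3 + u₄ ^ 3 + u₅ ^ 3) - (v₁ ^ 3 + v₂ ^ 3 + v₃ ^ 3) = 0)
    (m₁₁ : |u₁ - v₁| ≤ A₁ - B₁) (m₂₁ : |u₂ - v₁| ≤ A₂ - B₁) (m₃₁ : |u₃ - v₁| ≤ A₃ - B₁) (m₄₁ : |u₄ - v₁| ≤ A₄ - B₁) (m₅₁ : |u₅ - v₁| ≤ A₅ - B₁)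
    (m₁₂ : |u₁ - v₂| ≤ A₁ - B₂) (m₂₂ : |u₂ - v₂| ≤ A₂ - B₂) (m₃₂ : |u₃ - v₂| ≤ A₃ - B₂) (m₄₂ : |u₄ - v₂| ≤ A₄ - B₂) (m₅₂ : |u₅ - v₂| ≤ A₅ - B₂)
    (m₁₃ : |u₁ - v₃| ≤ A₁ - B₃) (m₂₃ : |u₂ - v₃| ≤ A₂ - B₃) (m₃₃ : |u₃ - v₃| ≤ A₃ - B₃) (m₄₃ : |u₄ - v₃| ≤ A₄ - B₃) (m₅₃ : |u₅ - v₃| ≤ A₅ - B₃)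
    (h₁₂ : u₁ ≤ u₂) (h₂₃ : u₂ ≤ u₃) (h₃ : u₃ < v₁) (hv₁₂ : v₁ ≤ v₂) (hv₂₃ : v₂ ≤ v₃) (h₄ : v₃ < u₄) (h₄₅ : u₄ ≤ u₅)
    (l : ℝ) (hl : 0 ≤ l) :
    0 ≤ (1 / 2) * ((A₁ ^ 2 + A₂ ^ 2 + A₃ ^ 2 + A₄ ^ 2 + A₅ ^ 2) - (B₁ ^ 2 + B₂ ^ 2 + B₃ ^ 2)) * ((u₁ ^ 2 + u₂ ^ 2 + u₃ ^ 2 + u₄ ^ 2 + u₅ ^ 2) - (v₁ ^ 2 + v₂ ^ 2 + v₃ ^ 2))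
        + ((A₁ * u₁ + A₂ * u₂ + A₃ * u₃ + A₄ * u₄ + A₅ * u₅) - (B₁ * v₁ + B₂ * v₂ + B₃ * v₃)) ^ 2
        - 3 * ((A₁ ^ 2 * u₁ ^ 2 + A₂ ^ 2 * u₂ ^ 2 + A₃ ^ 2 * u₃ ^ 2 + A₄ ^ 2 * u₄ ^ 2 + A₅ ^ 2 * u₅ ^ 2) - (B₁ ^ 2 * v₁ ^ 2 + B₂ ^ 2 * v₂ ^ 2 + B₃ ^ 2 * v₃ ^ 2))
      + l * (3 * ((u₁ ^ 4 + u₂ ^ 4 + u₃ ^ 4 + u₄ ^ 4 + u₅ ^ 4) - (v₁ ^ 4 + v₂ ^ 4 + v₃ ^ 4)) - (3 / 2) * ((u₁ ^ 2 + u₂ ^ 2 + u₃ ^ 2 + u₄ ^ 2 + u₅ ^ 2) - (v₁ ^ 2 + v₂ ^ 2 + v₃ ^ 2)) ^ 2) := by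
  have key := Glam_nonneg_222 A₅ A₄ A₃ A₂ A₁ B₃ B₂ B₁ (-u₅) (-u₄) (-u₃) (-u₂) (-u₁) (-v₃) (-v₂) (-v₁)
      (by linarith) (by linarith) (by linear_combination (-1 : ℝ) * hP1) (by linear_combination hP2)
      (by linear_combination (-1 : ℝ) * hP4)
      (by rw [show (-u₅) - (-v₃) = -(u₅ - v₃) by ring, abs_neg]; exact m₅₃)
      (by rw [show (-u₄) - (-v₃) = -(u₄ - v₃) by ring, abs_neg]; exact m₄₃)
      (by rw [show (-u₃) - (-v₃) = -(u₃ - v₃) by ring, abs_neg]; exact m₃₃)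
      (by rw [show (-u₂) - (-v₃) = -(u₂ - v₃) by ring, abs_neg]; exact m₂₃)
      (by rw [show (-u₁) - (-v₃) = -(u₁ - v₃) by ring, abs_neg]; exact m₁₃)
      (by rw [show (-u₅) - (-v₂) = -(u₅ - v₂) by ring, abs_neg]; exact m₅₂)
      (by rw [show (-u₄) - (-v₂) = -(u₄ - v₂) by ring, abs_neg]; exact m₄₂)
      (by rw [show (-u₃) - (-v₂) = -(u₃ - v₂) by ring, abs_neg]; exact m₃₂)
      (by rw [show (-u₂) - (-v₂) = -(u₂ - v₂) by ring, abs_neg]; exact m₂₂)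
      (by rw [show (-u₁) - (-v₂) = -(u₁ - v₂) by ring, abs_neg]; exact m₁₂)
      (by rw [show (-u₅) - (-v₁) = -(u₅ - v₁) by ring, abs_neg]; exact m₅₁)
      (by rw [show (-u₄) - (-v₁) = -(u₄ - v₁) by ring, abs_neg]; exact m₄₁)
      (by rw [show (-u₃) - (-v₁) = -(u₃ - v₁) by ring, abs_neg]; exact m₃₁)
      (by rw [show (-u₂) - (-v₁) = -(u₂ - v₁) by ring, abs_neg]; exact m₂₁)
      (by rw [show (-u₁) - (-v₁) = -(u₁ - v₁) by ring, abs_neg]; exact m₁₁)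
      (by linarith) (by linarith) (by linarith) (by linarith) (by linarith) (by linarith) (by linarith) l hl
  have e : (1 / 2) * ((A₁ ^ 2 + A₂ ^ 2 + A₃ ^ 2 + A₄ ^ 2 + A₅ ^ 2) - (B₁ ^ 2 + B₂ ^ 2 + B₃ ^ 2)) * ((u₁ ^ 2 + u₂ ^ 2 + u₃ ^ 2 + u₄ ^ 2 + u₅ ^ 2) - (v₁ ^ 2 + v₂ ^ 2 + v₃ ^ 2))
        + ((A₁ * u₁ + A₂ * u₂ + A₃ * u₃ + A₄ * u₄ + A₅ * u₅) - (B₁ * v₁ + B₂ * v₂ + B₃ * v₃)) ^ 2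
        - 3 * ((A₁ ^ 2 * u₁ ^ 2 + A₂ ^ 2 * u₂ ^ 2 + A₃ ^ 2 * u₃ ^ 2 + A₄ ^ 2 * u₄ ^ 2 + A₅ ^ 2 * u₅ ^ 2) - (B₁ ^ 2 * v₁ ^ 2 + B₂ ^ 2 * v₂ ^ 2 + B₃ ^ 2 * v₃ ^ 2))
      + l * (3 * ((u₁ ^ 4 + u₂ ^ 4 + u₃ ^ 4 + u₄ ^ 4 + u₅ ^ 4) - (v₁ ^ 4 + v₂ ^ 4 + v₃ ^ 4)) - (3 / 2) * ((u₁ ^ 2 + u₂ ^ 2 + u₃ ^ 2 + u₄ ^ 2 + u₅ ^ 2) - (v₁ ^ 2 + v₂ ^ 2 + v₃ ^ 2)) ^ 2)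
      = (1 / 2) * ((A₅ ^ 2 + A₄ ^ 2 + A₃ ^ 2 + A₂ ^ 2 + A₁ ^ 2) - (B₃ ^ 2 + B₂ ^ 2 + B₁ ^ 2)) * (((-u₅) ^ 2 + (-u₄) ^ 2 + (-u₃) ^ 2 + (-u₂) ^ 2 + (-u₁) ^ 2) - ((-v₃) ^ 2 + (-v₂) ^ 2 + (-v₁) ^ 2))
        + ((A₅ * (-u₅) + A₄ * (-u₄) + A₃ * (-u₃) + A₂ * (-u₂) + A₁ * (-u₁)) - (B₃ * (-v₃) + B₂ * (-v₂) + B₁ * (-v₁))) ^ 2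
        - 3 * ((A₅ ^ 2 * (-u₅) ^ 2 + A₄ ^ 2 * (-u₄) ^ 2 + A₃ ^ 2 * (-u₃) ^ 2 + A₂ ^ 2 * (-u₂) ^ 2 + A₁ ^ 2 * (-u₁) ^ 2) - (B₃ ^ 2 * (-v₃) ^ 2 + B₂ ^ 2 * (-v₂) ^ 2 + B₁ ^ 2 * (-v₁) ^ 2))
      + l * (3 * (((-u₅) ^ 4 + (-u₄) ^ 4 + (-u₃) ^ 4 + (-u₂) ^ 4 + (-u₁) ^ 4) - ((-v₃) ^ 4 + (-v₂) ^ 4 + (-v₁) ^ 4)) - (3 / 2) * (((-u₅) ^ 2 + (-u₄) ^ 2 + (-u₃) ^ 2 + (-u₂) ^ 2 + (-u₁) ^ 2) - ((-v₃) ^ 2 + (-v₂) ^ 2 + (-v₁) ^ 2)) ^ 2) := by ring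
  rw [e]; exact key

end Summit.HodgeConjecture.HodgeConjecture.WeilClassTestFormatFiveThreeEmptyPatterns
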